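import Summits.Ventures.HSemireg.Mod4CarrierMiddleDegree
import Summits.Ventures.HSemireg.Mod4CarrierWeilSquare

/-!
# Venture HSemireg — MOD-4 line: the τ-FORM of THEOREM R_f's middle degree ON THE p4 CARRIER
# (`w ∧ w = 2t · Θ^{2n}/(2n)!  ⇒  R_n = (r_n + 2)C(2n,n) − 2r_n − dim ker(M_f(q) − t)`)

HONEST FRAMING. Part of the Lean index of the computation cell `pub-hsemireg` (widening group W3, seat w3-mod4-1 gen 6; file of
record `HOME/widen/W3/MOD4-OFFSPLIT-w3mod4.md` §12).  Finite-dimensional exterior algebra over a field ONLY (p4's carrier of Weil type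
`(n,n)`: adapted basis `ℓ_a, m_a` of `V`, `L = span ℓ`, `Θ = Σ_a ℓ_a ∧ m_a`, `Ecl q (2n) = Σ_m q_m Θ^m/m!`, `wUp n` / `wLow n` the two
block top forms, `LMprod (2n) = Π_a(ℓ_a∧m_a) = Θ^{2n}/(2n)!`, `S_n` the degree-`n` contraction span): no abelian variety, no sheaf, no Ext
group, no semiregularity map; nothing here says that HC, HC_CM or HC_AV holds; no Literature fact is declared or used.  WHAT IS PROVED
(proof-only, one theorem): **`finrank_S_weil_nn_middle_of_sq`** — for every field of characteristic `≠ 2`, every `n ≥ 1`, every `q`,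
`a, b ≠ 0`, and `w = a·wUp + b·wLow`: if `w ∧ w = (2t) • LMprod (2n)` then
`dim S_n(Ecl q (2n) + w) + 2·r_n + dim ker(M_f(q) − t) = (r_n + 2)·C(2n,n)` (`r_n = rank H_n(q)`, `M_f = Mod4.middleM n q`) — seat g6's
`finrank_S_weil_nn_middle'` (eigen-parameter `(−1)ⁿab`, `Mod4CarrierMiddleDegree.lean`) combined with `eq_of_weil_sq_nn` (`w∧w =
2(−1)ⁿab·Θ^{2n}/(2n)!`, `Mod4CarrierWeilSquare.lean`).  READING (MOD4-OFFSPLIT §1 / §10.1 / (E2); the frame identification is NOT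
asserted in Lean): with `V = H¹(Y)`, `L = H^{0,1}`, `Θ = h` and `∫` the cup-product integral (`∫Θ^{2n}/(2n)! = D`), `t = ∫w²/(2D) =
(−1)ⁿ(w,w)_χ/(2D) = (−1)ⁿτ`, so this is THEOREM R_f's middle clause `R_n = (r_n + 2)C(2n,n) − 2r_n − dim ker(M_f − (−1)ⁿτ)` with the
eigen-parameter COMPUTED FROM THE CLASS ITSELF — the «sign pin» is a kernel identity.
All statements and proofs: w3-mod4-1 g6 (2026-08-23).  Namespace `Summit.Ventures.HSemireg.Mod4Carrier`.
References: [BuchweitzFlenner2008HH] Prop. 6.4.4 (why these operators); [BourbakiAlgebre1a3] Ch. III §7.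
-/

open Module

namespace Summit.Ventures.HSemireg.Mod4Carrier

open Summit.Ventures.HSemireg.WedgeBridge Summit.Ventures.HSemireg.WeilCarrier
open Summit.Ventures.HSemireg.Wedge.Hankel Summit.Ventures.HSemireg.Mod4

variable {K : Type*} [Field K] {n : ℕ} {V : Type*} [AddCommGroup V] [Module K V] (bV : Basis (Fin ((n + n) + (n + n))) K V)

/-- **THEOREM R_f, MIDDLE DEGREE, τ-FORM ON THE p4 CARRIER** (characteristic `≠ 2`, every `n ≥ 1`, every `q`, `a, b ≠ 0`): for
`w = a·w₊ + b·w₋` with `w ∧ w = 2t · Θ^{2n}/(2n)!`,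
`dim S_n(Ecl q (2n) + w) + 2·r_n + dim ker(M_f(q) − t) = (r_n + 2)·C(2n,n)` — the proof sheet's
`R_n = (r_n + 2)C(2n,n) − 2r_n − dim ker(M_f − (−1)ⁿτ)` with `(−1)ⁿτ = ∫w²/(2D)` read off the carrier. [cite: BuchweitzFlenner2008HH, Prop. 6.4.4] -/
theorem finrank_S_weil_nn_middle_of_sq (hn : 1 ≤ n) (q : ℕ → K) {a b t : K} (ha : a ≠ 0) (hb : b ≠ 0) (h2 : (2 : K) ≠ 0)
    (ht : (a • wUp bV n + b • wLow bV n) * (a • wUp bV n + b • wLow bV n) = (2 * t) • LMprod bV (n + n)) :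
    Module.finrank K (S K (Lsp bV) n (Ecl bV q (n + n) + a • wUp bV n + b • wLow bV n)) +
        2 * (hankel1 K (n + n) n q).rank +
        Module.finrank K (LinearMap.ker (Matrix.toLin' (middleM n q) - t • LinearMap.id)) =
      ((hankel1 K (n + n) n q).rank + 2) * (n + n).choose n := by
  rw [eq_of_weil_sq_nn bV hn h2 ht]
  exact finrank_S_weil_nn_middle' bV hn q ha hb

end Summit.Ventures.HSemireg.Mod4Carrier
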